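import Literature.MathematicalPhysics.QuantumFieldTheory.Balaban1983to89.B8Ineq159FlatCubeMemberTransplant
import Literature.MathematicalPhysics.QuantumFieldTheory.Balaban1983to89.B8FlatOperatorsTranslateLocal
import Literature.MathematicalPhysics.QuantumFieldTheory.Balaban1983to89.B8Eq131CubesRecDictionary
import Literature.MathematicalPhysics.QuantumFieldTheory.Balaban1983to89.B8Eq131CubesAdmissibleRec
import Literature.MathematicalPhysics.QuantumFieldTheory.Balaban1983to89.B8CubeMemberZdRec
import Literature.MathematicalPhysics.QuantumFieldTheory.Balaban1983to89.B8Eq138LandauFlatOrthogonalRec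
import Literature.MathematicalPhysics.QuantumFieldTheory.Balaban1983to89.B8Eq191FlatStencils
import Literature.MathematicalPhysics.QuantumFieldTheory.Balaban1983to89.B7SectEFLinearisationRec

/-!
# `Balaban1983to89.B8Ineq159FlatCubeMemberPrintedRec` — [Balaban1985RegularSpaces] (1.59) p. 86 AT `U₀ = 1` ON THE CUBE MEMBER `{□_j}` OF (1.131), FOR THE RECORD's
# CENTRED TOWER ([Balaban1987RG1] (0.3)): the named fact `Ineq159FlatCubeMemberPrintedZ d L` — the RECORD TWIN of `B8Ineq159FlatCubeMemberPrinted.Ineq159FlatCubeMemberPrinted`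
# — and its PROOF for every odd `L = ℓ + 1 ≥ 5`, obtained from the engine's theorem `B8Ineq159FlatCubeMemberTransplant.ineq159FlatCubeMemberPrinted_holds` by the
# (T2) TRANSLATION `x ↦ x + ctrShift L k·𝟙` (every letter of (1.59) at the flat background is translation-covariant)

statement-level skeleton of published theorems with citation tags; proofs where landed; nothing here is a claim about the Yang–Mills mass gap

CITATION HEADER (lean-in-tree rule).  Cell `pub-ymgap` (HUMAN RULING D-0062), «N05-REC» road (director-ym №254∕№255; LEAD PEN dag-n05-e g37; desk `R6-PLAN.md` §2 rows (e)∕(f):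
the engine crown `B8Prop6DentedCubeMemberScalarGammaOfNamedFacts.gaugedBoundB8D_dentedMember_scalar_γ_of_namedFacts` consumes the flat named fact
`Ineq159FlatCubeMemberPrinted d L`; its record twin consumes THIS file's `Ineq159FlatCubeMemberPrintedZ d L`).  [6] = [Balaban1985RegularSpaces] (1.59) p. 86, (1.62) p. 87,
(1.31) p. 82, (1.38) p. 82, (1.131)–(1.132) p. 99, p. 98; [4] = [Balaban1985BackgroundPropagators] Thm 3.3 p. 399; [B6] = [Balaban1984PropagatorsII] Prop. 2.6 p. 247, (2.3)
p. 224; [I] = [Balaban1987RG1] (0.3) p. 252 (CENTRED blocks «Bᵏ(y) = {x : |x_μ − Lᵏy_μ| ≤ (Lᵏ−1)∕2}»).  `--kind definition --supports stmt-QuantumFields-20541` (K0⁷; count-neutral).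
REUSED BY NAME: the engine fact and its proof (`B8Ineq159FlatCubeMemberPrinted`, `B8Ineq159FlatCubeMemberTransplant`; dag-n05-c), `B8CubeMemberTorusSizeLines.{exists_near_of_ne_zero,
exists_bound_of_near}`, `B8FlatOperatorsTranslateLocal.{covDerivFwd_one_translate, Jcur_one_translate, covLap_one_translate}`, `B9Eq316TowerFlatIsOneStep.linCovIter_one_left` (TRUE for
the ENGINE's corner averaging — used on the engine side only; DO-NOT-REKEY respected: no `linCovIterZ` anywhere in this file), `B8Eq191FlatStencils.QT_flat_apply`; dag-n07-w3's dictionary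
`B8Eq131CubesRecDictionary.{inBox_sqZ_iff_add_ctrShift, inBox_inZ_iff_add_ctrShift, flm_add_ctrShift}`, `B8Eq131CubesAdmissibleRec.mem_cubeFamZ_iff_add_ctrShift`; dag-n05-d's
`B8Eq138LandauZdRec.{QTZ, IsLandau138Z}`, `B8Eq138LandauFlatOrthogonalRec.QTZ_flat_apply`, `B7SectEFLinearisationRec.{linQZ, linQIterZ}`; dag-n05-e's `B8CubeMemberZdRec.{cubeLamZ, cubeLamSZ}`.

WHY TRANSLATION AND NOT A SECOND TORUS TRANSPLANT.  For the SAME unit-lattice datum `(a, M, ρ, k)` the record's centred family `cubeFamZ ∕ cubeLamSZ` is the engine's corner family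
`cubeFam ∕ cubeLamS` translated: fine sites by `c_k := ctrShift L k`, level-`j` labels by `c_{k−j}`, and `c_k = Lʲ·c_{k−j} + c_j` ties the levels (`ctrShift_add`), so ONE translation
of the fine lattice aligns the centred block hierarchy with the corner one at every level `j ≤ k` (the TOP-ANCHORED bookkeeping of `Node00.TorusCoverBlockAveragingZd`).  At the
flat background every letter of (1.59) is translation-covariant: `J`, `D^η_1`, `Δ^η_1` (engine lemmas), the touch predicates, the multiplier form (1.38) (`QTZ ↦ QT`: §3), and the
STRAIGHT centred averages `linQIterZ` (§4: `linQIterZ L φ j z = linQIter L φ(· − c_k) j (z + c_{k−j})`).  So the record fact follows from the engine fact on `ℤᵈ` — the engine's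
seven torus-transplant modules (`B8CubeMemberTorus*`) are not re-keyed.  THE AVERAGING DATUM of the twin is print's STRAIGHT average `‖Lʲη·Q_j(iηφ)(c)‖ ≤ N` written with
`linQIterZ` (the [B6] operator (1.18), centred): the record's composite `linCovIterZ L 1` differs from it by the carried letter `dΘ_j` (`B7Prop4FlatCarriedLetterRec.linCovIterZ_one_eq`,
director-ym №269 route (a)), which the consumer absorbs into the datum (`B₁′ = B₁ − dΘ_j`, `B8Eq156KLevelLocalRec`).

WHAT IS PROVED (sorry-free).  §1 def `cubeLamBPZ` (print's constraint-bond class, centred; twin of `cubeLamBP`) + `mem_cubeLamBPZ_iff`.  §2 the dictionary: `image_add_ctrShift_cubeFamZ`,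
`sideTouches_image_add_iff`, `mem_cubeLamZ_iff_add_ctrShift`, `mem_cubeLamSZ_iff_add_ctrShift`, `image_add_ctrShift_cubeLamSZ`, `mem_cubeLamBPZ_iff_add_ctrShift`.  §3 ★
`isLandau138_image_of_isLandau138Z` ((1.38), record blocking, for `A` ⟹ (1.38), engine blocking, for `A(· − c_k)` on the translated tower; any `𝔸`, flat background, `m ≤ k`).  §4
`linQZ_eq_sum`, ★ `linQIterZ_eq_linQIter_add_ctrShift`.  §5 def ★★ `Ineq159FlatCubeMemberPrintedZ d L` (the twin statement), ★★ `ineq159FlatCubeMemberPrintedZ_of_printed` (engine fact ⟹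
record fact, odd `L`), ★★★ `ineq159FlatCubeMemberPrintedZ_holds (d ℓ) (4 ≤ ℓ) (Odd (ℓ+1))` — UNCONDITIONAL.
HONEST SCOPE.  A flat-background bookkeeping transfer of an already-proved theorem; no new estimate; nothing of [4]∕[6]∕[B6]∕[I] newly asserted; `HThm4Rec` UNDISCHARGED; N05 ∕ N07
NOT discharged; counts unmoved (typed 28∕28 · discharged 8∕28); one finite 𝕋⁴ programme at fixed ε — nothing continuum ∕ ℝ⁴ ∕ OS ∕ mass gap ∕ Clay.  No `instance`, no `notation`, no `sorry`.
-/

set_option autoImplicit false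
noncomputable section
open scoped BigOperators

namespace Literature.MathematicalPhysics.QuantumFieldTheory.Balaban1983to89.B8Ineq159FlatCubeMemberPrintedRec

open B7Prop1Explicit (e e_apply boxVec asum_seg_natCast)
open B7Prop1Local (InBox)
open B7Prop3Flat (linQ)
open B7Prop4Flat (linQIter linQIter_succ linQ_eq_sum)
open B7Prop4GeneralLevels (linCovIter)
open B9Eq316TowerFlatIsOneStep (linCovIter_one_left)
open B7SectEFLinearisationRec (linQZ linQIterZ linQIterZ_zero linQIterZ_succ)
open BlockAveragingZd (offZ ctrShift ctrShift_succ)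
open Literature.MathematicalPhysics.QuantumLattice (blockMap)
open B8Ineq132 (covDerivFwd covDeriv BondTouches PlaqTouches)
open B8Eq140Level (SideTouches IsSide)
open B8Eq146AExpansion (iEta norm_iEta_le)
open B8Eq155JBound (Jcur)
open B8Eq138LandauZd (QT IsLandau138 covLap covDivB)
open B8Eq138LandauZdRec (QTZ IsLandau138Z)
open B8Eq138LandauFlatOrthogonalRec (QTZ_flat_apply)
open B8Eq191FlatStencils (QT_flat_apply covDeriv_flat_apply covLap_flat_apply)
open B8Eq131Cubes (cube sqLo sqHi inLo inHi flm)
open B8Eq131CubesRec (sqLoZ sqHiZ inLoZ inHiZ)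
open B8Eq131CubesRecDictionary (inBox_sqZ_iff_add_ctrShift inBox_inZ_iff_add_ctrShift flm_add_ctrShift)
open B8Eq131CubesAdmissible (cubeFam)
open B8Eq131CubesAdmissibleRec (cubeFamZ mem_cubeFamZ_iff_add_ctrShift)
open B8Eq119TwistedAxialRec (flmZ)
open B8CubeMemberZd (cubeLam cubeLamS)
open B8CubeMemberZdRec (cubeLamZ cubeLamSZ)
open B8Ineq159FlatCubeMemberPrinted (cubeLamBP mem_cubeLamBP_iff Ineq159FlatCubeMemberPrinted)
open B8Ineq159FlatCubeMemberTransplant (ineq159FlatCubeMemberPrinted_holds)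
open B8CubeMemberTorusSizeLines (exists_near_of_ne_zero exists_bound_of_near)
open B8FlatOperatorsTranslateLocal (covDerivFwd_one_translate Jcur_one_translate covLap_one_translate)

variable {d : ℕ}

/-! ## §1 Print's constraint-bond class of the truncated member, centred tower -/

/-- (RECORD TWIN of `B8Ineq159FlatCubeMemberPrinted.cubeLamBP`.) **PRINT'S CONSTRAINT-BOND CLASS AT LEVEL `j` OF THE TRUNCATION `m` OF THE CUBE MEMBER, CENTRED TOWER**
([B6] (2.3) for bonds, (1.31)'s contours): a level-`j` bond `c = ⟨c₋, c₋ + e_κ⟩` with at least one end in `□_j^{(j)} = [sqLoZ j, sqHiZ j]` and no end inside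
`□_{j+1}^{(j)} = [inLoZ j, inHiZ j]` when `j < m`; empty above `m`. [cite: Balaban1984PropagatorsII, (2.3) p.224; Balaban1985RegularSpaces, (1.31) p.82, (1.131) p.99; Balaban1987RG1, (0.3) p.252] -/
def cubeLamBPZ (L : ℕ) (a : B7Prop1Explicit.Site d) (M ρ k m j : ℕ) : Set (B7Prop1Explicit.Site d × Fin d) :=
  {c | j ≤ m ∧ (InBox (sqLoZ L a ρ k j) (sqHiZ L a M ρ k j) c.1 ∨ InBox (sqLoZ L a ρ k j) (sqHiZ L a M ρ k j) (c.1 + e c.2)) ∧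
    (j < m → ¬ InBox (inLoZ L a ρ k j) (inHiZ L a M ρ k j) c.1 ∧ ¬ InBox (inLoZ L a ρ k j) (inHiZ L a M ρ k j) (c.1 + e c.2))}

/-- Membership, unfolded (`Iff.rfl`). [cite: Balaban1984PropagatorsII, (2.3) p.224] -/
theorem mem_cubeLamBPZ_iff (L : ℕ) (a : B7Prop1Explicit.Site d) (M ρ k m j : ℕ) (c : B7Prop1Explicit.Site d × Fin d) :
    c ∈ cubeLamBPZ L a M ρ k m j ↔ j ≤ m ∧ (InBox (sqLoZ L a ρ k j) (sqHiZ L a M ρ k j) c.1 ∨ InBox (sqLoZ L a ρ k j) (sqHiZ L a M ρ k j) (c.1 + e c.2)) ∧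
      (j < m → ¬ InBox (inLoZ L a ρ k j) (inHiZ L a M ρ k j) c.1 ∧ ¬ InBox (inLoZ L a ρ k j) (inHiZ L a M ρ k j) (c.1 + e c.2)) := Iff.rfl

/-! ## §2 The (T2) dictionary: centred family = corner family translated (fine sites by `c_k`, level-`j` labels by `c_{k−j}`) -/

/-- `x + t ∈ S + t ↔ x ∈ S`. [folklore] [cite: Balaban1987RG1, (0.3) p.252 (bookkeeping)] -/
private theorem add_mem_image_add_iff (S : Set (B7Prop1Explicit.Site d)) (t x : B7Prop1Explicit.Site d) : x + t ∈ (fun y => y + t) '' S ↔ x ∈ S :=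
  ⟨fun ⟨y, hy, h⟩ => by rwa [← add_right_cancel h], fun hx => ⟨x, hx, rfl⟩⟩

/-- ★ **The centred cube family is the corner family translated by `c_k`** (odd `L`, every `j`): `cubeFamZ top L a M ρ k j + c_k·𝟙 = cubeFam top L a M ρ k j`.
[cite: Balaban1985RegularSpaces, p.98, (1.131) p.99; Balaban1987RG1, (0.3) p.252] -/
theorem image_add_ctrShift_cubeFamZ {L : ℕ} (hL : Odd L) (top : Bool) (a : B7Prop1Explicit.Site d) (M ρ k j : ℕ) :
    (fun x : B7Prop1Explicit.Site d => x + fun _ => (ctrShift L k : ℤ)) '' cubeFamZ top L a M ρ k j = cubeFam top L a M ρ k j := by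
  ext y
  constructor
  · rintro ⟨x, hx, rfl⟩
    exact (mem_cubeFamZ_iff_add_ctrShift hL top a M ρ k j x).1 hx
  · intro hy
    refine ⟨y - fun _ => (ctrShift L k : ℤ), ?_, sub_add_cancel y _⟩
    rw [mem_cubeFamZ_iff_add_ctrShift hL, sub_add_cancel]
    exact hy

/-- `BondTouches` is translation-covariant. [cite: Balaban1985RegularSpaces, p.77 (bond convention before (1.5))] -/
private theorem bondTouches_image_add_iff (S : Set (B7Prop1Explicit.Site d)) (t x : B7Prop1Explicit.Site d) (μ : Fin d) :
    BondTouches ((fun y => y + t) '' S) (x + t) μ ↔ BondTouches S x μ := by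
  unfold BondTouches
  rw [show x + t + e μ = (x + e μ) + t by abel]
  simp only [add_mem_image_add_iff]

/-- `PlaqTouches` is translation-covariant. [cite: Balaban1985RegularSpaces, p.77 (plaquette convention before (1.5))] -/
private theorem plaqTouches_image_add_iff (S : Set (B7Prop1Explicit.Site d)) (t x : B7Prop1Explicit.Site d) (μ ν : Fin d) :
    PlaqTouches ((fun y => y + t) '' S) (x + t) μ ν ↔ PlaqTouches S x μ ν := by
  unfold PlaqTouches
  rw [show x + t + e μ = (x + e μ) + t by abel, show x + t + e ν = (x + e ν) + t by abel,
    show x + e μ + t + e ν = (x + e μ + e ν) + t by abel]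
  simp only [add_mem_image_add_iff]

/-- `IsSide` is translation-covariant. [cite: Balaban1985RegularSpaces, p.77 (plaquette convention before (1.5))] -/
private theorem isSide_add_iff (z : B7Prop1Explicit.Site d) (κ ν : Fin d) (y t : B7Prop1Explicit.Site d) (τ : Fin d) :
    IsSide (z + t) κ ν (y + t) τ ↔ IsSide z κ ν y τ := by
  unfold IsSide
  rw [show z + t + e κ = (z + e κ) + t by abel, show z + t + e ν = (z + e ν) + t by abel]
  simp only [add_left_inj]

/-- **`SideTouches` is translation-covariant**: the bond `⟨y + t, τ⟩` is a side of a plaquette touching `S + t` iff `⟨y, τ⟩` is one of a plaquette touching `S`.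
[cite: Balaban1985RegularSpaces, p.77 (plaquette convention before (1.5)); Balaban1987RG1, (0.3) p.252] -/
theorem sideTouches_image_add_iff (S : Set (B7Prop1Explicit.Site d)) (t y : B7Prop1Explicit.Site d) (τ : Fin d) :
    SideTouches ((fun x => x + t) '' S) (y + t) τ ↔ SideTouches S y τ := by
  constructor
  · rintro ⟨z, κ, ν, hκν, hp, hs⟩
    refine ⟨z - t, κ, ν, hκν, ?_, ?_⟩
    · rw [← plaqTouches_image_add_iff S t, sub_add_cancel]; exact hp
    · rw [← isSide_add_iff _ κ ν _ t, sub_add_cancel]; exact hs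
  · rintro ⟨z, κ, ν, hκν, hp, hs⟩
    exact ⟨z + t, κ, ν, hκν, (plaqTouches_image_add_iff S t z κ ν).2 hp, (isSide_add_iff z κ ν y t τ).2 hs⟩

/-- **`Λ_j` of the centred family through the label shift** (depth `k − j`): `z ∈ cubeLamZ … j ↔ z + c_{k−j} ∈ cubeLam … j`. [cite: Balaban1985RegularSpaces, (1.5) p.77, (1.131) p.99; Balaban1987RG1, (0.3) p.252] -/
theorem mem_cubeLamZ_iff_add_ctrShift (L : ℕ) (a : B7Prop1Explicit.Site d) (M ρ k j : ℕ) (z : B7Prop1Explicit.Site d) :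
    z ∈ cubeLamZ L a M ρ k j ↔ (z + fun _ => (ctrShift L (k - j) : ℤ)) ∈ cubeLam L a M ρ k j := by
  simp only [cubeLamZ, cubeLam, Set.mem_setOf_eq, inBox_sqZ_iff_add_ctrShift, inBox_inZ_iff_add_ctrShift]

/-- ★ **The truncated restriction sets through the label shift**: `z ∈ cubeLamSZ … m j ↔ z + c_{k−j} ∈ cubeLamS … m j` (every `m, j`).
[cite: Balaban1985RegularSpaces, (1.68) p.88, (1.131) p.99; Balaban1987RG1, (0.3) p.252] -/
theorem mem_cubeLamSZ_iff_add_ctrShift (L : ℕ) (a : B7Prop1Explicit.Site d) (M ρ k m j : ℕ) (z : B7Prop1Explicit.Site d) :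
    z ∈ cubeLamSZ L a M ρ k m j ↔ (z + fun _ => (ctrShift L (k - j) : ℤ)) ∈ cubeLamS L a M ρ k m j := by
  unfold cubeLamSZ cubeLamS
  by_cases hjm : j < m
  · simp only [if_pos hjm, mem_cubeLamZ_iff_add_ctrShift]
  · by_cases hje : j = m
    · simp only [if_neg hjm, if_pos hje, Set.mem_setOf_eq, inBox_sqZ_iff_add_ctrShift]
    · simp only [if_neg hjm, if_neg hje, Set.mem_empty_iff_false]

/-- The same as an identity of sets: `cubeLamSZ … m j + c_{k−j}·𝟙 = cubeLamS … m j`. [cite: Balaban1985RegularSpaces, (1.68) p.88; Balaban1987RG1, (0.3) p.252] -/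
theorem image_add_ctrShift_cubeLamSZ (L : ℕ) (a : B7Prop1Explicit.Site d) (M ρ k m j : ℕ) :
    (fun z : B7Prop1Explicit.Site d => z + fun _ => (ctrShift L (k - j) : ℤ)) '' cubeLamSZ L a M ρ k m j = cubeLamS L a M ρ k m j := by
  ext y
  constructor
  · rintro ⟨z, hz, rfl⟩
    exact (mem_cubeLamSZ_iff_add_ctrShift L a M ρ k m j z).1 hz
  · intro hy
    refine ⟨y - fun _ => (ctrShift L (k - j) : ℤ), ?_, sub_add_cancel y _⟩
    rw [mem_cubeLamSZ_iff_add_ctrShift, sub_add_cancel]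
    exact hy

/-- ★ **Print's bond class through the label shift**: `⟨z, κ⟩ ∈ cubeLamBPZ … m j ↔ ⟨z + c_{k−j}, κ⟩ ∈ cubeLamBP … m j`. [cite: Balaban1984PropagatorsII, (2.3) p.224; Balaban1985RegularSpaces, (1.31) p.82; Balaban1987RG1, (0.3) p.252] -/
theorem mem_cubeLamBPZ_iff_add_ctrShift (L : ℕ) (a : B7Prop1Explicit.Site d) (M ρ k m j : ℕ) (c : B7Prop1Explicit.Site d × Fin d) :
    c ∈ cubeLamBPZ L a M ρ k m j ↔ ((c.1 + fun _ => (ctrShift L (k - j) : ℤ)), c.2) ∈ cubeLamBP L a M ρ k m j := by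
  rw [mem_cubeLamBPZ_iff, mem_cubeLamBP_iff]
  simp only [inBox_sqZ_iff_add_ctrShift, inBox_inZ_iff_add_ctrShift, add_right_comm c.1 (e c.2)]

/-! ## §3 (1.38) in multiplier form: record blocking for `A` ⟹ engine blocking for the translate `A(· − c_k)` -/

section Landau

variable {𝔸 : Type*} [NormedRing 𝔸] [NormedAlgebra ℂ 𝔸] [CompleteSpace 𝔸]

omit [CompleteSpace 𝔸] in
/-- `D^{η*}_1` of a translated potential. [cite: Balaban1985RegularSpaces, (1.1) p.76] -/
private theorem covDivB_one_comp_sub (η : ℝ) (A : B7Prop1Explicit.Site d → Fin d → 𝔸) (t x : B7Prop1Explicit.Site d) :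
    covDivB η (1 : B7Prop1Explicit.Site d → Fin d → 𝔸ˣ) (fun y κ => A (y - t) κ) x = covDivB η (1 : B7Prop1Explicit.Site d → Fin d → 𝔸ˣ) A (x - t) := by
  unfold covDivB
  refine Finset.sum_congr rfl fun κ _ => ?_
  rw [covDeriv_flat_apply, covDeriv_flat_apply]
  dsimp only
  rw [sub_right_comm x (e κ) t]

omit [CompleteSpace 𝔸] in
/-- `Δ^η_1` of a translated function. [cite: Balaban1985BackgroundPropagators, (3.23) p.394] -/
private theorem covLap_one_comp_sub (η : ℝ) (f : B7Prop1Explicit.Site d → 𝔸) (t x : B7Prop1Explicit.Site d) :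
    covLap η (1 : B7Prop1Explicit.Site d → Fin d → 𝔸ˣ) (fun y => f (y - t)) x = covLap η (1 : B7Prop1Explicit.Site d → Fin d → 𝔸ˣ) f (x - t) := by
  rw [covLap_flat_apply, covLap_flat_apply]
  simp only [add_sub_right_comm, sub_right_comm _ (e _) t]

/-- The prelude's block map at block size `Lʲ` is `flm L j`. [folklore] [cite: Balaban1985RegularSpaces, (1.6) p.77] -/
private theorem blockMap_pow_eq_flm (L j : ℕ) (x : B7Prop1Explicit.Site d) : blockMap (L ^ j) x = flm L j x := by
  funext i; simp [blockMap, flm]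

/-- ★ **(1.38) IN MULTIPLIER FORM, RECORD BLOCKING ⟹ ENGINE BLOCKING FOR THE TRANSLATE** (odd `L`, truncation `m ≤ k`, flat background, any `𝔸`): if
`Δ^η_1↾Ω₀(D^{η*}_1A) = Q′(1)ᵀμ` on `Ω₀` with the CENTRED transposes (`QTZ`, multiplier `μ_j` on `Λ_j`), then for `A′ := A(· − c_k·𝟙)` the same holds on `Ω₀ + c_k·𝟙` with the
CORNER transposes (`QT`), the shifted tower `Λ_j + c_{k−j}·𝟙` and the multiplier `μ_j(· − c_{k−j}·𝟙)`: the level-`j` corner label of `x + c_k` is the centred label of `x` plus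
`c_{k−j}` (`flm_add_ctrShift`). [cite: Balaban1985RegularSpaces, (1.38) p.82; Balaban1985BackgroundPropagators, (3.24)–(3.25) p.394; Balaban1987RG1, (0.3) p.252] -/
theorem isLandau138_image_of_isLandau138Z {L : ℕ} (hL : Odd L) {m k : ℕ} (hmk : m ≤ k) {η : ℝ} {Ω₀ : Set (B7Prop1Explicit.Site d)} {Λs : ℕ → Set (B7Prop1Explicit.Site d)}
    {A : B7Prop1Explicit.Site d → Fin d → 𝔸} (h : IsLandau138Z L m η Ω₀ Λs (1 : B7Prop1Explicit.Site d → Fin d → 𝔸ˣ) A) :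
    IsLandau138 L m η ((fun x : B7Prop1Explicit.Site d => x + fun _ => (ctrShift L k : ℤ)) '' Ω₀)
      (fun j => (fun z : B7Prop1Explicit.Site d => z + fun _ => (ctrShift L (k - j) : ℤ)) '' Λs j) (1 : B7Prop1Explicit.Site d → Fin d → 𝔸ˣ)
      (fun y κ => A (y - fun _ => (ctrShift L k : ℤ)) κ) := by
  obtain ⟨μ, hμ⟩ := h
  refine ⟨fun j z => μ j (z - fun _ => (ctrShift L (k - j) : ℤ)), ?_⟩
  rintro _ ⟨x, hx, rfl⟩
  have hind : ((fun x : B7Prop1Explicit.Site d => x + fun _ => (ctrShift L k : ℤ)) '' Ω₀).indicator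
      (covDivB η (1 : B7Prop1Explicit.Site d → Fin d → 𝔸ˣ) (fun y κ => A (y - fun _ => (ctrShift L k : ℤ)) κ)) =
      fun y => Ω₀.indicator (covDivB η (1 : B7Prop1Explicit.Site d → Fin d → 𝔸ˣ) A) (y - fun _ => (ctrShift L k : ℤ)) := by
    funext y
    by_cases hy : (y - fun _ => (ctrShift L k : ℤ)) ∈ Ω₀
    · have hy' : y ∈ (fun x : B7Prop1Explicit.Site d => x + fun _ => (ctrShift L k : ℤ)) '' Ω₀ := ⟨_, hy, sub_add_cancel y _⟩
      rw [Set.indicator_of_mem hy', Set.indicator_of_mem hy, covDivB_one_comp_sub]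
    · have hy' : y ∉ (fun x : B7Prop1Explicit.Site d => x + fun _ => (ctrShift L k : ℤ)) '' Ω₀ := by
        rintro ⟨x', hx', hxy⟩
        exact hy (by rw [← hxy, add_sub_cancel_right]; exact hx')
      rw [Set.indicator_of_notMem hy', Set.indicator_of_notMem hy]
  rw [hind, covLap_one_comp_sub, add_sub_cancel_right, hμ x hx, QTZ_flat_apply hL, QT_flat_apply]
  refine Finset.sum_congr rfl fun j hj => ?_
  have hjk : j ≤ k := (Nat.lt_succ_iff.mp (Finset.mem_range.mp hj)).trans hmk
  rw [blockMap_pow_eq_flm, flm_add_ctrShift hL hjk]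
  congr 1
  by_cases hw : flmZ L j x ∈ Λs j
  · rw [Set.indicator_of_mem hw, Set.indicator_of_mem ((add_mem_image_add_iff _ _ _).2 hw), add_sub_cancel_right]
  · rw [Set.indicator_of_notMem hw, Set.indicator_of_notMem (fun h' => hw ((add_mem_image_add_iff _ _ _).1 h'))]

end Landau

/-! ## §4 The straight centred averages are the corner averages of the translate, read at shifted labels -/

section Averages

variable {𝔸 : Type*} [NormedRing 𝔸] [NormedAlgebra ℂ 𝔸]

/-- `L·(Q₀B)_c`, centred block, as a double finite sum: `Σ_{r} L^{−d} Σ_{i<L} B(q + offZ r + ie_κ, κ)`. [cite: Balaban1985Averaging, (122) p.36; Balaban1987RG1, (0.3) p.252] -/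
theorem linQZ_eq_sum (L : ℕ) (B : B7Prop1Explicit.Site d → Fin d → 𝔸) (q : B7Prop1Explicit.Site d) (κ : Fin d) :
    linQZ L B q κ = ∑ r : Fin d → Fin L, (((L : ℝ) ^ d)⁻¹) • ∑ i : Fin L, B (q + offZ L r + ((i : ℕ) : ℤ) • e κ) κ := by
  simp only [linQZ, asum_seg_natCast, ← Fin.sum_univ_eq_sum_range]

/-- ★ **`linQIterZ L φ j z = linQIter L φ(· − c_k) j (z + c_{k−j})`** (odd `L`, `j ≤ k`): the `j`-fold straight CENTRED average of `φ` at the level-`j` label `z` is the `j`-fold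
straight CORNER average of the translate `φ(· − c_k·𝟙)` at the shifted label — one induction on `j`, the step being `offZ r + c_{n+1} = L·c_n + boxVec r` (`ctrShift_succ`).
[cite: Balaban1985Averaging, (127) p.37, (122) p.36; Balaban1984PropagatorsI, (1.18) p.20; Balaban1987RG1, (0.3) p.252] -/
theorem linQIterZ_eq_linQIter_add_ctrShift {L : ℕ} (hL : Odd L) (φ : B7Prop1Explicit.Site d → Fin d → 𝔸) (k : ℕ) :
    ∀ (j : ℕ), j ≤ k → ∀ (z : B7Prop1Explicit.Site d) (κ : Fin d),
      linQIterZ L φ j z κ =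
        linQIter L (fun w ν => φ (w - fun _ => (ctrShift L k : ℤ)) ν) j (z + fun _ => (ctrShift L (k - j) : ℤ)) κ := by
  intro j
  induction j with
  | zero => intro _ z κ; rw [linQIterZ_zero, B7Prop4Flat.linQIter_zero, Nat.sub_zero, add_sub_cancel_right]
  | succ j ih =>
    intro hj z κ
    rw [linQIterZ_succ, linQIter_succ, linQZ_eq_sum, linQ_eq_sum]
    refine Finset.sum_congr rfl fun r _ => ?_
    congr 1
    refine Finset.sum_congr rfl fun i _ => ?_
    rw [ih (Nat.le_of_succ_le hj)]
    congr 1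
    have hc : (ctrShift L (k - j) : ℤ) = (L : ℤ) * ctrShift L (k - (j + 1)) + (((L - 1) / 2 : ℕ) : ℤ) := by
      rw [show k - j = (k - (j + 1)) + 1 by omega, ctrShift_succ hL]; push_cast; ring
    funext ν
    simp only [Pi.add_apply, Pi.smul_apply, offZ, boxVec, smul_eq_mul, hc]
    ring

end Averages

/-! ## §5 The named fact for the record tower, and its proof by translation -/

/-- (RECORD TWIN of `B8Ineq159FlatCubeMemberPrinted.Ineq159FlatCubeMemberPrinted`.) **[Balaban1985RegularSpaces] (1.59) AT THE FLAT BACKGROUND `U₀ = 1` ON THE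
CENTRED CUBE FAMILY `{□_j}` OF (1.131), AVERAGING DATUM OVER PRINT'S CLASS** (= [4] Thm 3.3 at `U = 1` with Dirichlet exterior on `□₀`; [B6] Prop. 2.6 for the flat
`Δ_a = ∂*∂ + ∂R∂* + Q*aQ`): there are `B₀ > 0` and thresholds `ρ₀, M₀, N₀, R₀` such that for every `η > 0`, every cube datum `(a, M, ρ, k)`, `k ≥ 1`, on print's p. 98
big-block sub-lattice (`M₀ ≤ L^{s+1}`, `L^{s+1} ∣ ρ`, `L^{s+1} ∣ M`, `R·L^{s+1} ≤ ρ`, `R₀ ≤ R`, `N₀ + 1 ≤ R·L^{s+1}`, `ρ₀ ≤ ρ`), every truncation `1 ≤ m ≤ k` and every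
ℂ-valued bond function `φ` near `□₀` in the flat Landau gauge (1.38) for the RECORD blocking (`IsLandau138Z`, `Λ′`-tower `cubeLamSZ … m`): if `N ≥ 0` bounds (i)
`(Lʲη)³|J(φ)|` on the bonds of `□_j` (`cubeFamZ`), (ii) the un-normalised STRAIGHT centred averages `|Lʲη·Q_j(iηφ)(c)| = ‖linQIterZ L (iηφ) j c‖` on every bond `c` of
print's class `cubeLamBPZ … m j`, and (iii) `η|φ|` on the outer layer, then on every bond side-touching `□_j`: `(Lʲη)|φ| ≤ B₀N`, `(Lʲη)²|D^η_{1,ν}φ_τ| ≤ B₀N`,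
`(Lʲη)³|Δ^η_1φ_τ| ≤ B₀N` — print's «|A|₍₋₁₎, |∇^η A|₍₋₂₎, |Δ^η A|₍₋₃₎ ≦ B₀(|J|₍₋₃₎ + |B₁|)» at `U₀ = 1`, pointwise form (1.62), centred tower.  Named here; PROVED below
for odd `L ≥ 5` (`ineq159FlatCubeMemberPrintedZ_holds`).
[cite: Balaban1985RegularSpaces, (1.59) p.86, (1.62) p.87, (1.31) p.82, (1.38) p.82, (1.131)–(1.132) p.99, p.98; Balaban1985BackgroundPropagators, Thm 3.3 p.399, (3.47) p.398; Balaban1984PropagatorsII, Prop. 2.6 (2.136) p.247, (2.3) p.224; Balaban1987RG1, (0.3) p.252] -/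
def Ineq159FlatCubeMemberPrintedZ (d L : ℕ) : Prop :=
  ∃ B₀ ρ₀ M₀ : ℝ, ∃ N₀ R₀ : ℕ, 0 < B₀ ∧
    ∀ (η : ℝ), 0 < η → ∀ (a : B7Prop1Explicit.Site d) (M ρ k s R : ℕ), 1 ≤ k →
      M₀ ≤ (L : ℝ) ^ (s + 1) → L ^ (s + 1) ∣ ρ → L ^ (s + 1) ∣ M → R * L ^ (s + 1) ≤ ρ → R₀ ≤ R →
      N₀ + 1 ≤ R * L ^ (s + 1) → ρ₀ ≤ (ρ : ℝ) →
      ∀ m, 1 ≤ m → m ≤ k → ∀ φ : B7Prop1Explicit.Site d → Fin d → ℂ,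
        IsLandau138Z L m η (cubeFamZ false L a M ρ k 0) (cubeLamSZ L a M ρ k m) (1 : B7Prop1Explicit.Site d → Fin d → ℂˣ) φ →
        (∀ (y : B7Prop1Explicit.Site d) (τ : Fin d), (∀ j, j ≤ m → ¬ SideTouches (cubeFamZ false L a M ρ k j) y τ) → φ y τ = 0) →
        ∀ N : ℝ, 0 ≤ N →
          (∀ j, j ≤ m → ∀ (y : B7Prop1Explicit.Site d) (τ : Fin d), BondTouches (cubeFamZ false L a M ρ k j) y τ →
              ((L : ℝ) ^ j * η) ^ 3 * ‖Jcur η (1 : B7Prop1Explicit.Site d → Fin d → ℂˣ) φ τ y‖ ≤ N) →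
          (∀ j, j ≤ m → ∀ c ∈ cubeLamBPZ L a M ρ k m j, ‖linQIterZ L (iEta η φ) j c.1 c.2‖ ≤ N) →
          (∀ (y : B7Prop1Explicit.Site d) (τ : Fin d), ¬ BondTouches (cubeFamZ false L a M ρ k 0) y τ → η * ‖φ y τ‖ ≤ N) →
          ∀ j, j ≤ m → ∀ (y : B7Prop1Explicit.Site d) (τ : Fin d), SideTouches (cubeFamZ false L a M ρ k j) y τ →
            ((L : ℝ) ^ j * η) * ‖φ y τ‖ ≤ B₀ * N ∧
            (∀ ν : Fin d, ((L : ℝ) ^ j * η) ^ 2 *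
                ‖covDerivFwd η (1 : B7Prop1Explicit.Site d → Fin d → ℂˣ) ν (fun z => φ z τ) y‖ ≤ B₀ * N) ∧
            ((L : ℝ) ^ j * η) ^ 3 * ‖covLap η (1 : B7Prop1Explicit.Site d → Fin d → ℂˣ) (fun z => φ z τ) y‖ ≤ B₀ * N

/-- ★★ **THE RECORD FACT FROM THE ENGINE FACT, BY TRANSLATION** (odd `L = ℓ + 1`): apply the engine's (1.59) to `ψ := φ(· − c_k·𝟙)`; its hypotheses are the record's read
through §2–§4 (family, touch predicates, (1.38), `J`, the straight averages — here `linCovIter L 1 (iηψ) j = linQIter L (iηψ) j` on the ENGINE side by `linCovIter_one_left`, `ψ`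
being bounded as a field supported near `□₀` — and the outer layer), and its conclusion at `⟨y + c_k·𝟙, τ⟩` is the record's at `⟨y, τ⟩` (`D^η_1`, `Δ^η_1` translation-covariant).
Same constants `B₀, ρ₀, M₀, N₀, R₀`. [cite: Balaban1985RegularSpaces, (1.59) p.86, (1.62) p.87, p.98; Balaban1987RG1, (0.3) p.252] -/
theorem ineq159FlatCubeMemberPrintedZ_of_printed (d ℓ : ℕ) (hodd : Odd (ℓ + 1)) (h : Ineq159FlatCubeMemberPrinted (d + 1) (ℓ + 1)) :
    Ineq159FlatCubeMemberPrintedZ (d + 1) (ℓ + 1) := by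
  classical
  obtain ⟨B₀, ρ₀, M₀, N₀, R₀, hB₀, H⟩ := h
  refine ⟨B₀, ρ₀, M₀, N₀, R₀, hB₀, ?_⟩
  intro η hη a M ρ k s R hk hM0 hρdiv hMdiv hRρ hR0 hN01 hρ0 m hm1 hmk φ hLan hsupp N hN0 hJ hQ hout j hjm y τ hside
  have hL1 : 1 ≤ ℓ + 1 := Nat.succ_pos ℓ
  -- the translation vector and the translated field
  set tK : B7Prop1Explicit.Site (d + 1) := fun _ => (ctrShift (ℓ + 1) k : ℤ) with htK
  set ψ : B7Prop1Explicit.Site (d + 1) → Fin (d + 1) → ℂ := fun w => φ (w - tK) with hψ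
  have hfam : ∀ j', (fun x : B7Prop1Explicit.Site (d + 1) => x + tK) '' cubeFamZ false (ℓ + 1) a M ρ k j' = cubeFam false (ℓ + 1) a M ρ k j' :=
    fun j' => image_add_ctrShift_cubeFamZ hodd false a M ρ k j'
  -- support of `ψ`: off every touching bond of the corner family
  have hsuppψ : ∀ (y' : B7Prop1Explicit.Site (d + 1)) (τ' : Fin (d + 1)),
      (∀ j', j' ≤ m → ¬ SideTouches (cubeFam false (ℓ + 1) a M ρ k j') y' τ') → ψ y' τ' = 0 := by
    intro y' τ' hno
    refine hsupp (y' - tK) τ' fun j' hj' hs => hno j' hj' ?_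
    rw [← hfam j', ← sub_add_cancel y' tK]
    exact (sideTouches_image_add_iff _ _ _ _).2 hs
  -- (1.38) for `ψ`, engine blocking
  have hLanψ : IsLandau138 (ℓ + 1) m η (cubeFam false (ℓ + 1) a M ρ k 0) (cubeLamS (ℓ + 1) a M ρ k m)
      (1 : B7Prop1Explicit.Site (d + 1) → Fin (d + 1) → ℂˣ) ψ := by
    have h1 := isLandau138_image_of_isLandau138Z hodd hmk hLan
    have hΛ : (fun j' => (fun z : B7Prop1Explicit.Site (d + 1) => z + fun _ => (ctrShift (ℓ + 1) (k - j') : ℤ)) '' cubeLamSZ (ℓ + 1) a M ρ k m j') =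
        cubeLamS (ℓ + 1) a M ρ k m := funext fun j' => image_add_ctrShift_cubeLamSZ (ℓ + 1) a M ρ k m j'
    rw [hfam 0, hΛ] at h1
    exact h1
  -- (i) the `J` bound for `ψ`
  have hJψ : ∀ j', j' ≤ m → ∀ (y' : B7Prop1Explicit.Site (d + 1)) (τ' : Fin (d + 1)), BondTouches (cubeFam false (ℓ + 1) a M ρ k j') y' τ' →
      (((ℓ + 1 : ℕ) : ℝ) ^ j' * η) ^ 3 * ‖Jcur η (1 : B7Prop1Explicit.Site (d + 1) → Fin (d + 1) → ℂˣ) ψ τ' y'‖ ≤ N := by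
    intro j' hj' y' τ' hb
    rw [hψ, Jcur_one_translate]
    refine hJ j' hj' (y' - tK) τ' ?_
    rw [← bondTouches_image_add_iff _ tK, sub_add_cancel, hfam]
    exact hb
  -- `ψ` is bounded (supported near `□₀`), so the engine composite at `U₀ = 1` is the straight average
  obtain ⟨Mψ, hMψ0, hMψ⟩ := exists_bound_of_near a fun z τ' hz => exists_near_of_ne_zero a hmk hsuppψ hz
  have hb : ∀ w ν, ‖iEta η ψ w ν‖ ≤ η * Mψ := fun w ν => norm_iEta_le hη.le hMψ w ν
  -- (ii) the averaging datum for `ψ` over print's class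
  have hQψ : ∀ j', j' ≤ m → ∀ c ∈ cubeLamBP (ℓ + 1) a M ρ k m j',
      ‖linCovIter (ℓ + 1) (1 : B7Prop1Explicit.Site (d + 1) → Fin (d + 1) → ℂˣ) (iEta η ψ) j' c.1 c.2‖ ≤ N := by
    intro j' hj' c hc
    rw [linCovIter_one_left (ℓ + 1) hL1 _ (by positivity) hb j']
    have hiEta : iEta η ψ = fun w ν => iEta η φ (w - tK) ν := rfl
    have key := linQIterZ_eq_linQIter_add_ctrShift hodd (iEta η φ) k j' (hj'.trans hmk)
      (c.1 - fun _ => (ctrShift (ℓ + 1) (k - j') : ℤ)) c.2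
    rw [sub_add_cancel] at key
    rw [hiEta, ← key]
    refine hQ j' hj' ((c.1 - fun _ => (ctrShift (ℓ + 1) (k - j') : ℤ)), c.2) ?_
    rw [mem_cubeLamBPZ_iff_add_ctrShift, sub_add_cancel]
    exact hc
  -- (iii) the outer layer for `ψ`
  have houtψ : ∀ (y' : B7Prop1Explicit.Site (d + 1)) (τ' : Fin (d + 1)), ¬ BondTouches (cubeFam false (ℓ + 1) a M ρ k 0) y' τ' → η * ‖ψ y' τ'‖ ≤ N := by
    intro y' τ' hnb
    refine hout (y' - tK) τ' fun hb' => hnb ?_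
    rw [← hfam 0, ← sub_add_cancel y' tK]
    exact (bondTouches_image_add_iff _ _ _ _).2 hb'
  -- the engine fact at the translated bond
  have hside' : SideTouches (cubeFam false (ℓ + 1) a M ρ k j) (y + tK) τ := by
    rw [← hfam j]; exact (sideTouches_image_add_iff _ _ _ _).2 hside
  obtain ⟨h1, h2, h3⟩ := H η hη a M ρ k s R hk hM0 hρdiv hMdiv hRρ hR0 hN01 hρ0 m hm1 hmk ψ hLanψ hsuppψ N hN0 hJψ hQψ houtψ
    j hjm (y + tK) τ hside'
  refine ⟨?_, fun ν => ?_, ?_⟩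
  · simpa only [hψ, add_sub_cancel_right] using h1
  · have h2ν := h2 ν
    simp only [hψ] at h2ν
    rwa [covDerivFwd_one_translate, add_sub_cancel_right] at h2ν
  · have hc : covLap η (1 : B7Prop1Explicit.Site (d + 1) → Fin (d + 1) → ℂˣ) (fun z => ψ z τ) (y + tK) =
        covLap η (1 : B7Prop1Explicit.Site (d + 1) → Fin (d + 1) → ℂˣ) (fun z => φ z τ) (y + tK - tK) :=
      covLap_one_translate η tK (fun w => φ w τ) (y + tK)
    rwa [hc, add_sub_cancel_right] at h3

/-- ★★★ **(1.59) AT `U₀ = 1` ON THE CENTRED CUBE MEMBER, UNCONDITIONAL for every odd `L = ℓ + 1 ≥ 5`**: the engine's theorem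
`B8Ineq159FlatCubeMemberTransplant.ineq159FlatCubeMemberPrinted_holds` ([4] Thm 3.3 at `U = 1` by transplant to lit-balaban's multi-level torus estimates) moved to the record tower
by `ineq159FlatCubeMemberPrintedZ_of_printed`. [cite: Balaban1985RegularSpaces, (1.59) p.86, (1.62) p.87; Balaban1985BackgroundPropagators, Thm 3.3 p.399; Balaban1984PropagatorsII, Prop. 2.6 (2.136) p.247; Balaban1987RG1, (0.3) p.252] -/
theorem ineq159FlatCubeMemberPrintedZ_holds (d ℓ : ℕ) (hℓ : 4 ≤ ℓ) (hodd : Odd (ℓ + 1)) : Ineq159FlatCubeMemberPrintedZ (d + 1) (ℓ + 1) :=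
  ineq159FlatCubeMemberPrintedZ_of_printed d ℓ hodd (ineq159FlatCubeMemberPrinted_holds d ℓ hℓ hodd)

end Literature.MathematicalPhysics.QuantumFieldTheory.Balaban1983to89.B8Ineq159FlatCubeMemberPrintedRec

end
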